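import Literature.MathematicalPhysics.QuantumLattice.ApproximatingHamiltonianProofs
import HarnessLib

/-!
# Typical thermal states: the exact METTS decomposition of the finite-dimensional Gibbs state (White 2009; Wietek et al. 2021 §7.1)

Topic `MathematicalPhysics/QuantumLattice` (family `hubbard`; cell `hubbard-cq`, the `T > 0` side of the
cuprate question). This is the one piece of MATHEMATICS in the finite-temperature numerical source
typed in `FiniteTemperatureStripeOnset.lean` (Wietek–He–White–Georges–Stoudenmire, PRX 11 (2021)
031007, §7.1 "Basic METTS algorithm"; the construction is S. R. White, PRL 102 (2009) 190601): the
minimally-entangled-typical-thermal-state (METTS) representation of the Gibbs state is EXACT — the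
sampling algorithm is "unbiased", only the imaginary-time evolution is approximated numerically.

For a Hamiltonian `H` (a Hermitian matrix on a finite index type `n`, the basis vectors `|i⟩`,
`i : n`, playing the product states `|σ_i⟩`) and inverse temperature `β`:

* `mettsWeight β H i = P(i) = ⟨i| e^{-βH} |i⟩` (White: "`P(i) ≡ ⟨i|exp(-βH)|i⟩`"; Wietek et al.:
  "`p_i = ⟨σ_i|e^{-βH}|σ_i⟩`"), the diagonal entry of the tree's `Matrix.gibbsWeight β H`;
* `mettsVector β H i = e^{-βH/2} |i⟩`, the UNNORMALISED typical thermal state (the METTS is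
  `|φ(i)⟩ = P(i)^{-1/2} e^{-βH/2} |i⟩`; we keep the normalisation as the scalar `P(i)` to stay in exact
  arithmetic), `mettsExpect β H A i = ⟨e^{-βH/2} i, A e^{-βH/2} i⟩` and the normalised measurement
  `mettsStateExpect β H A i = ⟨φ(i)|A|φ(i)⟩ = mettsExpect / P(i)`;
* `mettsTransition β H i j = |⟨j|φ(i)⟩|²`, the collapse probability of the METTS Markov chain
  (Wietek et al.: "`T_{i→j} = |⟨ψ_i|σ_j⟩|²`").

Proved (all for Hermitian `H`): `P(i) = ‖e^{-βH/2} i‖² > 0` (`mettsWeight_eq_dotProduct`,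
`mettsWeight_pos`; White: the weights are "unnormalized probabilities", Wietek et al.: "all weights
`p_i` are manifestly real and non-negative. Therefore one does not encounter a sign problem");
`Σ_i P(i) = Z` (`sum_mettsWeight`; White: "the partition function is given by `Z = tr ρ = Σ_i P(i)`");
the decomposition `tr(e^{-βH} A) = Σ_i ⟨e^{-βH/2} i, A e^{-βH/2} i⟩`
(`trace_gibbsWeight_mul_eq_sum_mettsExpect`) and its normalised form
`⟨A⟩_β = Σ_i (P(i)/Z) ⟨φ(i)|A|φ(i)⟩` (`gibbsState_eq_sum_mettsWeight_mul`; White's displayed formula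
for `⟨A⟩`, Wietek et al.'s (7.1) second display); the collapse probabilities sum to one and satisfy
DETAILED BALANCE `P(i) T_{i→j} = P(j) T_{j→i}` (`sum_mettsTransition`, `metts_detailed_balance`;
Wietek et al.: "which fulfills the detailed balance equations"), so `P` is stationary for the chain;
and the infinite-temperature end `β = 0`: `e^{0} |i⟩ = |i⟩`, `P(i) = 1` (`mettsVector_zero`,
`mettsWeight_zero`; Wietek et al. §3: "At infinite temperature, they are classical product states").

Tree vocabulary reused, not restated: `Matrix.gibbsWeight`, `Matrix.partitionFn`, `Matrix.gibbsState`
(`FinDimSpectrum.lean`), `gibbsWeight_mul_gibbsWeight` (`e^{-sH} e^{-tH} = e^{-(s+t)H}`,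
`ApproximatingHamiltonianProofs.lean`), `isHermitian_gibbsWeight`, `posDef_gibbsWeight`. No facts
(`def … : Prop`) are introduced; nothing here is specific to the Hubbard model or to matrix product
states (the entanglement/"minimal" aspect of METTS is about the choice of basis and is not formalised).
-/

noncomputable section

open scoped Matrix.Norms.L2Operator ComplexOrder
open Matrix

namespace Literature.MathematicalPhysics.QuantumLattice

variable {n : Type*} [Fintype n] [DecidableEq n]

/-- The METTS weight of the basis state `i`: `P(i) = ⟨i| e^{-βH} |i⟩`, the `i`-th diagonal entry of
the Gibbs weight `e^{-βH}`. [cite: WhiteSR2009, p. 1 (definition of `P(i)`)]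
[cite: WietekEtAl2021, §7.1 (Basic METTS algorithm)] -/
def mettsWeight (β : ℝ) (H : Matrix n n ℂ) (i : n) : ℂ :=
  gibbsWeight β H i i

/-- The unnormalised typical thermal state grown from the basis state `i`: `e^{-βH/2} |i⟩` (the METTS
is this vector divided by `√P(i)`). [cite: WhiteSR2009, p. 1 (definition of `|φ(i)⟩`)]
[cite: WietekEtAl2021, §7.1 (Basic METTS algorithm)] -/
def mettsVector (β : ℝ) (H : Matrix n n ℂ) (i : n) : n → ℂ :=
  gibbsWeight (β / 2) H *ᵥ Pi.single i 1

/-- The unnormalised METTS measurement `⟨e^{-βH/2} i, A e^{-βH/2} i⟩ = P(i) ⟨φ(i)|A|φ(i)⟩`.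
[cite: WhiteSR2009, p. 1] [cite: WietekEtAl2021, §7.1 (Basic METTS algorithm)] -/
def mettsExpect (β : ℝ) (H A : Matrix n n ℂ) (i : n) : ℂ :=
  star (mettsVector β H i) ⬝ᵥ (A *ᵥ mettsVector β H i)

/-- The normalised METTS measurement `⟨φ(i)|A|φ(i)⟩ = ⟨e^{-βH/2} i, A e^{-βH/2} i⟩ / P(i)` (the
`i`-th term of the Monte Carlo time series). [cite: WhiteSR2009, p. 1 (display for `⟨A⟩`)]
[cite: WietekEtAl2021, §7.1 (Basic METTS algorithm)] -/
def mettsStateExpect (β : ℝ) (H A : Matrix n n ℂ) (i : n) : ℂ :=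
  (mettsWeight β H i)⁻¹ * mettsExpect β H A i

/-- The collapse (transition) probability of the METTS Markov chain,
`T_{i→j} = |⟨j|φ(i)⟩|² = |⟨j| e^{-βH/2} |i⟩|² / P(i)`. [cite: WietekEtAl2021, §7.1 (Basic METTS algorithm)]
[cite: WhiteSR2009, p. 2 ("thermal step")] -/
def mettsTransition (β : ℝ) (H : Matrix n n ℂ) (i j : n) : ℝ :=
  ‖mettsVector β H i j‖ ^ 2 / (mettsWeight β H i).re

section API

variable (β : ℝ) {H : Matrix n n ℂ}

/-- `e^{-βH/2} e^{-βH/2} = e^{-βH}` (the tree's `gibbsWeight_mul_gibbsWeight`).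
[cite: WietekEtAl2021, §7.1 (Basic METTS algorithm)] -/
theorem gibbsWeight_half_mul_half (H : Matrix n n ℂ) :
    gibbsWeight (β / 2) H * gibbsWeight (β / 2) H = gibbsWeight β H := by
  rw [gibbsWeight_mul_gibbsWeight, add_halves]

/-- Components of the unnormalised METTS: `(e^{-βH/2} |i⟩)_j = (e^{-βH/2})_{ji}`.
[cite: WhiteSR2009, p. 1] -/
theorem mettsVector_apply (H : Matrix n n ℂ) (i j : n) :
    mettsVector β H i j = gibbsWeight (β / 2) H j i := by
  rw [mettsVector, mulVec_single_one]
  rfl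

/-- At infinite temperature the METTS are the basis (product) states themselves: `e^{0} |i⟩ = |i⟩`.
[cite: WietekEtAl2021, §3 (METTS snapshots at finite temperature)] -/
theorem mettsVector_zero (H : Matrix n n ℂ) (i : n) : mettsVector 0 H i = Pi.single i 1 := by
  rw [mettsVector, zero_div, gibbsWeight_zero, one_mulVec]

/-- At infinite temperature every weight is `P(i) = 1`. [cite: WietekEtAl2021, §3] -/
theorem mettsWeight_zero (H : Matrix n n ℂ) (i : n) : mettsWeight 0 H i = 1 := by
  rw [mettsWeight, gibbsWeight_zero, one_apply_eq]

/-- **`P(i) = ‖e^{-βH/2} i‖²`**: for Hermitian `H` the METTS weight is the squared norm of the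
unnormalised typical state, `⟨i|e^{-βH}|i⟩ = ⟨e^{-βH/2} i, e^{-βH/2} i⟩` — the reason the METTS
`|φ(i)⟩ = P(i)^{-1/2} e^{-βH/2}|i⟩` is a unit vector. [cite: WhiteSR2009, p. 1]
[cite: WietekEtAl2021, §7.1 (Basic METTS algorithm)] -/
theorem mettsWeight_eq_dotProduct (hH : H.IsHermitian) (i : n) :
    mettsWeight β H i = star (mettsVector β H i) ⬝ᵥ mettsVector β H i := by
  have hW : (gibbsWeight (β / 2) H)ᴴ = gibbsWeight (β / 2) H := (isHermitian_gibbsWeight (β / 2) hH).eq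
  have hs : star (Pi.single i (1 : ℂ) : n → ℂ) = Pi.single i 1 := by
    rw [← Pi.single_star, star_one]
  rw [mettsVector, star_mulVec, ← dotProduct_mulVec, mulVec_mulVec, hW, gibbsWeight_half_mul_half, hs,
    single_one_dotProduct, mulVec_single_one, mettsWeight]
  rfl

/-- **No sign problem**: for Hermitian `H` every weight is strictly positive, `P(i) > 0` (a diagonal
entry of the positive definite `e^{-βH}`; "all weights `p_i` are manifestly real and non-negative.
Therefore one does not encounter a sign problem when using such an ensemble").
[cite: WietekEtAl2021, §7.1 (Basic METTS algorithm)] [cite: WhiteSR2009, p. 1] -/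
theorem mettsWeight_pos (hH : H.IsHermitian) (i : n) : 0 < mettsWeight β H i :=
  (posDef_gibbsWeight β hH).diag_pos

/-- Real form of `mettsWeight_pos`: `re P(i) > 0` and `im P(i) = 0`. [cite: WietekEtAl2021, §7.1] -/
theorem mettsWeight_re_pos (hH : H.IsHermitian) (i : n) :
    0 < (mettsWeight β H i).re ∧ (mettsWeight β H i).im = 0 := by
  have h := mettsWeight_pos β hH i
  rw [Complex.lt_def] at h
  exact ⟨by simpa using h.1, by simpa using h.2.symm⟩

/-- **`Σ_i P(i) = Z`**: the weights sum to the partition function ("Note that the partition function is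
given by `Z = tr ρ = Σ_i P(i)`"). [cite: WhiteSR2009, p. 1] [cite: WietekEtAl2021, §7.1, display for `p_i ≥ 0`] -/
theorem sum_mettsWeight (H : Matrix n n ℂ) : ∑ i, mettsWeight β H i = partitionFn β H := by
  simp [mettsWeight, partitionFn, Matrix.trace]

/-- **The METTS decomposition of the thermal trace**: for Hermitian `H`,
`tr(e^{-βH} A) = Σ_i ⟨e^{-βH/2} i, A e^{-βH/2} i⟩` (split `e^{-βH} = e^{-βH/2} e^{-βH/2}`, cycle the
trace, expand in the basis). [cite: WhiteSR2009, p. 1 (display for `⟨A⟩`)]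
[cite: WietekEtAl2021, §7.1 (Basic METTS algorithm), first display] -/
theorem trace_gibbsWeight_mul_eq_sum_mettsExpect (hH : H.IsHermitian) (A : Matrix n n ℂ) :
    (gibbsWeight β H * A).trace = ∑ i, mettsExpect β H A i := by
  have hW : (gibbsWeight (β / 2) H)ᴴ = gibbsWeight (β / 2) H := (isHermitian_gibbsWeight (β / 2) hH).eq
  have hs : ∀ i : n, star (Pi.single i (1 : ℂ) : n → ℂ) = Pi.single i 1 := fun i => by
    rw [← Pi.single_star, star_one]
  have hi : ∀ i : n,
      mettsExpect β H A i = (gibbsWeight (β / 2) H * A * gibbsWeight (β / 2) H) i i := by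
    intro i
    rw [mettsExpect, mettsVector, star_mulVec, ← dotProduct_mulVec, mulVec_mulVec, mulVec_mulVec, hW,
      hs, single_one_dotProduct, mulVec_single_one]
    rfl
  rw [← gibbsWeight_half_mul_half, Matrix.mul_assoc, trace_mul_comm, Matrix.trace]
  exact Finset.sum_congr rfl fun i _ => (hi i).symm

/-- **The Gibbs state as a METTS average** (unnormalised vectors):
`⟨A⟩_β = (Σ_i P(i))⁻¹ Σ_i ⟨e^{-βH/2} i, A e^{-βH/2} i⟩`. [cite: WhiteSR2009, p. 1 (display for `⟨A⟩`)]
[cite: WietekEtAl2021, §7.1 (Basic METTS algorithm)] -/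
theorem gibbsState_eq_sum_mettsExpect (hH : H.IsHermitian) (A : Matrix n n ℂ) :
    gibbsState β H A = (∑ i, mettsWeight β H i)⁻¹ * ∑ i, mettsExpect β H A i := by
  rw [gibbsState_apply, sum_mettsWeight, trace_gibbsWeight_mul_eq_sum_mettsExpect β hH]

/-- **White's formula** `⟨A⟩ = (1/Z) tr(ρ A) = Σ_i (P(i)/Z) ⟨φ(i)|A|φ(i)⟩` with the normalised METTS
measurements: the thermal average is the `P(i)/Z`-weighted mean of the per-state measurements, i.e. the
Monte Carlo estimator sampling `i` with probability `P(i)/Z` is unbiased.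
[cite: WhiteSR2009, p. 1 (display for `⟨A⟩`)] [cite: WietekEtAl2021, §7.1, second display and the limit display] -/
theorem gibbsState_eq_sum_mettsWeight_mul (hH : H.IsHermitian) (A : Matrix n n ℂ) :
    gibbsState β H A = (partitionFn β H)⁻¹ * ∑ i, mettsWeight β H i * mettsStateExpect β H A i := by
  rw [gibbsState_eq_sum_mettsExpect β hH, sum_mettsWeight]
  congr 1
  refine Finset.sum_congr rfl fun i _ => ?_
  rw [mettsStateExpect, mul_inv_cancel_left₀ (mettsWeight_pos β hH i).ne']

/-- `re P(i) = Σ_j |⟨j|e^{-βH/2}|i⟩|²` (the squared norm, componentwise). [cite: WhiteSR2009, p. 1] -/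
theorem mettsWeight_re_eq_sum_norm_sq (hH : H.IsHermitian) (i : n) :
    (mettsWeight β H i).re = ∑ j, ‖mettsVector β H i j‖ ^ 2 := by
  rw [mettsWeight_eq_dotProduct β hH, dotProduct, Complex.re_sum]
  refine Finset.sum_congr rfl fun j _ => ?_
  rw [Pi.star_apply, Complex.star_def, Complex.conj_mul', ← Complex.ofReal_pow, Complex.ofReal_re]

/-- **The collapse probabilities are a probability distribution**: `Σ_j T_{i→j} = 1` for Hermitian `H`.
[cite: WietekEtAl2021, §7.1 (Basic METTS algorithm) and §7.4 (Collapse)] -/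
theorem sum_mettsTransition (hH : H.IsHermitian) (i : n) : ∑ j, mettsTransition β H i j = 1 := by
  simp only [mettsTransition]
  rw [← Finset.sum_div, ← mettsWeight_re_eq_sum_norm_sq β hH, div_self (mettsWeight_re_pos β hH i).1.ne']

/-- **Detailed balance** `P(i) T_{i→j} = P(j) T_{j→i}`: both sides equal `|⟨j|e^{-βH/2}|i⟩|²`, which is
symmetric because `e^{-βH/2}` is Hermitian — hence `P(i)/Z` is a stationary distribution of the METTS
Markov chain ("The set of METTS are a fixed point of this process").
[cite: WietekEtAl2021, §7.1 (Basic METTS algorithm), the detailed balance display]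
[cite: WhiteSR2009, p. 2] -/
theorem metts_detailed_balance (hH : H.IsHermitian) (i j : n) :
    (mettsWeight β H i).re * mettsTransition β H i j =
      (mettsWeight β H j).re * mettsTransition β H j i := by
  have hi := (mettsWeight_re_pos β hH i).1.ne'
  have hj := (mettsWeight_re_pos β hH j).1.ne'
  have hsym : ‖mettsVector β H i j‖ = ‖mettsVector β H j i‖ := by
    rw [mettsVector_apply, mettsVector_apply, ← (isHermitian_gibbsWeight (β / 2) hH).apply j i, norm_star]
  simp only [mettsTransition]
  rw [mul_div_cancel₀ _ hi, mul_div_cancel₀ _ hj, hsym]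

end API

end Literature.MathematicalPhysics.QuantumLattice

end
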